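import Literature.MathematicalPhysics.QuantumFieldTheory.Balaban1983to89.B16StoppingRule

/-!
# `Balaban1983to89.B15Claim177` — [Balaban1989LargeFieldI] p. 177, the two geometric remarks opening Sect. 1:
# «the size must be greater than 20MR_k … greater than 40MR_k … the minimal size is approximately equal to
# 42(L/(L−1))MR_k» and «according to our rule of construction of the large field regions, for such a component all
# the regions connected with the last N steps are rectangular parallelepipeds» — typed in the EXISTING index models
# `…B14BoxFix` ((2.3) [III]) and `…B16SProfile` (the operation `S` of [LF-II] p. 384), with the provable content
# kernel-checked

statement-level skeleton of published theorems with citation tags; proofs where landed; nothing here is a claim about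
the Yang–Mills mass gap.

CITATION HEADER (lean-in-tree rule 2026-08-18).  T. Bałaban, *Large field renormalization. I. The basic step of the 𝐑
operation*, Commun. Math. Phys. **122**, 175–202 (1989), doi:10.1007/BF01257412, bib `Balaban1989LargeFieldI` (cell
paper B15 = [IV]; PDF held `paper:balaban1989-cmp122-large-field-i`, journal page = PDF page + 174; the passage below
is p. 177 [PDF 3], read on the materialised text `p0003.txt` and on the x2 render
`b2b-balaban-ref1/pages/1989-cmp122-large-field-I/…-p003-x2.png` by the reader seats of unit `lit-balaban-r12`).
Companion sources, used ONLY through declarations already in the tree: [III] = T. Bałaban, *Convergent renormalization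
expansions for lattice gauge theories*, Commun. Math. Phys. **119**, 243–285 (1988) [Balaban1988Convergent] (cell
paper B14), (2.3) p. 255 — typed as `B14BoxFix.Cond23` / `IsBox` / `FitsIn` over touching components `B14Components.tComp`
of cube-index sets; [LF-II] = T. Bałaban, *Large field renormalization. II*, Commun. Math. Phys. **122**, 355–392 (1989)
[Balaban1989LargeFieldII] (cell paper B16), p. 384 — the operation `S(Z) = Z′^{~10}` typed as `B16SProfile.Sop q =
collar^[10] ∘ closureIdx q` with iterates `Siter`, boxes of cubes `box c r`, and the printed per-step bound
*"L_{n−j} ≤ 42(1 − L^{−(n−j)})/(1 − L^{−1}) < 63"* (`Step.Budget.L_iter_lt_63`); the conditions (i), (ii) of p. 177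
themselves are `B16StoppingRule.CondI` / `CondII` (unit b2b-balaban-b02).  WHAT IS REPRODUCED: SKELETON row
`B15.Claim@177` (the last `absent` row of block B15), unit `lit-balaban-r12` gen 4 (reader/typer of block B15), HOME
`run/shared/lean/pub/lit-balaban/` (`lit-balaban-r12/ROWS-B15.md`).  NEW leaf module: imports `…B16StoppingRule`
(hence `…B16SProfile`, `…B14BoxFix`, `…B13ScaleTransfer`) and modifies nothing.

THE PRINTED TEXT (p. 177, verbatim).  *"Each term in the expansion (2.18) [III] has a large field region Λ^c_k. It is
a union of connected components. We consider components of almost the minimal possible size. Each renormalization step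
adds at least ten layers of MR_k-cubes, hence the size must be greater than 20MR_k. Passing to the next step it is
usually rescaled by L^{−1}, but in some steps the number R_k decreases by the factor L^{−1}, and adding ten new layers
of MR_k-cubes we get a region with a size greater than 40MR_k. It is easy to see that the minimal size is approximately
equal to 42(L/(L−1))MR_k. We consider components of sizes smaller than, or equal to 100MR_k. More precisely, we
consider the class of components such that each satisfies the following two properties: (i) it is contained in a
cube of the size 100MR_k, (ii) in the preceding N renormalization steps no new large field regions were created
inside this component, and the previous regions contained in it satisfy the condition (i) on the corresponding
scales. According to our rule of construction of the large field regions, for such a component all the regions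
connected with the last N steps are rectangular parallelepipeds. It will simplify some geometric considerations in
the future."*  The «rule of construction» is (2.3) of [III], p. 255: *"These large field regions satisfy the following
condition: if a component of Z_j is contained in a cube of the size 100MR_j (in the L^{−j}-lattice), then it is a
rectangular parallelepiped."*

READING (declared; the index model of `…B13ScaleTransfer` / `…B16SProfile` / `…B14BoxFix`, nothing new).  A region
of the scale-`k` lattice is its finite set of `MR_k`-cube indices `X ⊆ ℤᵈ` (`Pt d`); one renormalization step acts on
an OLD region (no new large fields created inside — the cleanliness clause of (ii)) by the operation `S` of [LF-II]
p. 384, `Sop q = collar^[10] ∘ closureIdx q` (cover by the cubes of the `q`-times coarser nested partition, `q =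
LR_{k+1}/R_k ∈ {1, L, …}`, then *"ten layers of such cubes"*); the no-gain step of print (*"in some steps the number
R_k decreases by the factor L^{−1}"*) is `q = 1` (`B16SProfile.Sop_one_box_subset`, cell DIVERGENCE.md D-b02g9.1);
«rectangular parallelepiped» is `B14BoxFix.IsBox` (a `Set`), here also in `Finset` form `pbox lo hi` / `IsPBox`
(`coe_pbox`, `IsPBox.isBox`, `isPBox_of_isBox`); «size greater than 20MR_k» is read as «contains a full box of
`2·10 + 1 = 21` cubes per side» (`box c 10 ⊆ …`), the only size notion the sentence *"adds at least ten layers"*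
determines.

WHAT IS TYPED AND PROVED.
* Part 1–2 (the mechanism behind «according to our rule of construction … rectangular parallelepipeds», and behind
  [LF-II] p. 384 *"It is easy to see that S^{n−j}(□) is a cube"*): the region-building operations send rectangular
  parallelepipeds to rectangular parallelepipeds EXACTLY — `collar_pbox` (one layer: `[lo,hi] ↦ [lo−1,hi+1]`),
  `iterate_collar_pbox`, `closureIdx_pbox` (cover by a coarser nested partition: `[lo,hi] ↦ [⌊lo/q⌋,⌊hi/q⌋]`, onto),
  `Sop_pbox`, `IsPBox.Sop`, `IsPBox.Siter`.
* Part 3 (the claim «all the regions connected with the last N steps are rectangular parallelepipeds»), in the two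
  readings the sentence admits: (A) DIRECTLY from (2.3) [III] — a region of the window is a component of the scale-`l`
  large field region `Z_l`, condition (ii) says it satisfies (i) there, (2.3) says it is then a box:
  `claim177_of_condII` (over `B16StoppingRule.CondI/CondII` and `B14BoxFix.Cond23`, window `k − N < l ≤ k`, plus the
  component itself by (i)); (B) CONSTRUCTIVELY — a region that is a box at the first scale of the window (by (A) there)
  stays a box under every later clean step: `claim177_Siter` (`IsBox ↑(S^{l}(X₀))` for all `l`).
* Part 4 (sizes): «adds at least ten layers … hence the size must be greater than 20MR_k» = `exists_box_subset_Sop`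
  (`box c 10 ⊆ S_q(X)` for non-empty `X`, any ratio `q`; `21^d ≤ |S_q(X)|`, `card_Sop_ge`; opposite cubes `20` apart in
  every coordinate, `exists_far_pair_Sop`); «in some steps [q = 1] … adding ten new layers … greater than 40MR_k» =
  `exists_box_subset_Sop_one_Sop` (`box c 20 ⊆ S_1(S_q(X))`); every iterate `S^{l+1}(X) ⊇ box c 10`
  (`exists_box_subset_Siter_succ`); the single-cube step two-sidedly: `box ⌊c/q⌋ (⌊r/q⌋ + 10) ⊆ S_q(□^{~r}) ⊆
  box ⌊c/q⌋ (⌊r/q⌋ + 11)` (`box_subset_Sop_box` + `B16SProfile.Sop_box_subset`).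
* Part 5 (the number `42(L/(L−1))`): the per-step size budget of [LF-II] p. 384 as the recursion `b_{m+1} = b_m/L + 42`,
  `b_0 = 0` (`budget`), its closed form `42(1 − L^{−m})/(1 − L^{−1})` = the printed bound for `L_m` (`budget_closed`),
  strictly increasing to and bounded by its limit `42·L/(L−1)` (`budget_lt_limit`, `tendsto_budget`) — the printed
  «approximately equal to 42(L/(L−1))MR_k» as a limit statement; `42·L/(L−1) ≤ 63 ⇔ L ≥ 3` (`limit_le_63_iff`) and
  `b_m < 63` for `L ≥ 3` (`budget_lt_63`, BY NAME `Step.Budget.L_iter_lt_63`), so the «minimal» regions stay inside the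
  `100MR_k` of condition (i); and, in the index model itself, a region grown from ONE cube under the drop control of
  (2.9) [III] satisfies (i): `condI_single_cube` (BY NAME `B16SProfile.Siter_singleton_subset_box`, radius `≤ 31`).

* Part 6 (v1.1, append-only; theorems only): the ALL-GAIN iterate of a single cube is small — after any number of
  steps with ratio `L` each, `S^{m}(□) ⊆ □′^{~r}` with `(L−1)·r ≤ 11L` (`allGain_iterate_subset_box`; `r ≤ 22` for
  `L ≥ 2`, `r ≤ 16` for `L ≥ 3`): the kernel evidence behind the GAPS.md G-B15-01 reading note.

HONEST SCOPE.  (a) The derivation of «≈ 42(L/(L−1))» is NOT printed on p. 177 (*"It is easy to see"*); the figure is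
reproduced here only as the `m → ∞` value of the per-step bound that [LF-II] p. 384 prints for the size `L_{n−j}` of
`S^{n−j}(□)`.  In the index model the exact single-cube step has radius `⌊r/q⌋ + 10 ≤ r′ ≤ ⌊r/q⌋ + 11` (Part 4), so
along ALL-GAIN steps (`q = L` throughout) the stationary linear size is about `21·L/(L−1)` cubes, and with the no-gain
steps allowed by (2.9) [III] it is at most `63` (`B16SProfile.RadInv`); which of these print calls «the minimal size»
is not specified in print — recorded in HOME `GAPS.md` (row G-B15-01), not adjudicated.  (b) «Size» is typed as box
containment / opposite cubes `20` apart, not as a metric diameter of a lattice domain.  (c) The cleanliness clause of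
(ii) («no new large field regions were created inside this component») is the parameter `Clean` of
`B16StoppingRule.CondII`, not modelled; that a clean step acts on an old region by `S` is [LF-II]'s own model (p. 384
*"an operation S, naturally connected with our procedure"*), adopted by `…B16SProfile`/`…B16StoppingRule` and here.
(d) Reading (A) of Part 3 is one line from (2.3) as typed (`Cond23` is a hypothesis on the regions `Z_l`, exactly as
(2.3) is an inductive condition in [III]); the fixpoint construction that PRODUCES (2.3) is `B14BoxFix.cond23_iterate`.
Value = the last absent B15 row typed with its provable content kernel-checked; NOT summit progress.
-/

namespace Literature.MathematicalPhysics.QuantumFieldTheory.Balaban1983to89.B15Claim177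

open Literature.MathematicalPhysics.QuantumFieldTheory.Balaban1983to89
open Literature.MathematicalPhysics.QuantumFieldTheory.Balaban1983to89.B13ScaleTransfer
open Literature.MathematicalPhysics.QuantumFieldTheory.Balaban1983to89.B16SProfile

noncomputable section

variable {d : ℕ}

/-! ## Part 1. Rectangular parallelepipeds of cube indices (`Finset` form of `B14BoxFix.ibox`) -/

/-- The rectangular parallelepiped of cube indices `lo ≤ y ≤ hi` (coordinatewise), as a `Finset` — *"rectangular
parallelepiped"* of cubes of one partition ((2.3) [III]; p. 177). [cite: Balaban1988Convergent, (2.3) p.255] -/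
def pbox (lo hi : Pt d) : Finset (Pt d) := Fintype.piFinset fun i => Finset.Icc (lo i) (hi i)

/-- Membership in a rectangular parallelepiped of cubes, coordinatewise (unfolding of the (2.3) notion). [cite: Balaban1988Convergent, (2.3) p.255] -/
theorem mem_pbox {lo hi y : Pt d} : y ∈ pbox lo hi ↔ ∀ i, lo i ≤ y i ∧ y i ≤ hi i := by
  simp [pbox, Fintype.mem_piFinset, Finset.mem_Icc]

/-- The `Finset` parallelepiped IS the `Set` parallelepiped `B14BoxFix.ibox` of the (2.3)-typing (dictionary between the
two carriers of the one printed notion). [cite: Balaban1988Convergent, (2.3) p.255] -/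
theorem coe_pbox (lo hi : Pt d) : (↑(pbox lo hi) : Set (Pt d)) = B14BoxFix.ibox lo hi := by
  ext y
  rw [Finset.mem_coe, mem_pbox]
  rfl

/-- The cube of cubes `□^{~r}` of `…B16SProfile` is the parallelepiped `[c − r, c + r]`. [folklore] -/
private theorem box_eq_pbox (c : Pt d) (r : ℕ) : box c r = pbox (fun i => c i - r) (fun i => c i + r) := rfl

/-- A single cube is the parallelepiped `[c, c]`. [folklore] -/
private theorem singleton_eq_pbox (c : Pt d) : ({c} : Finset (Pt d)) = pbox c c := by
  ext y
  rw [Finset.mem_singleton, mem_pbox]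
  constructor
  · rintro rfl i
    exact ⟨le_rfl, le_rfl⟩
  · intro h
    funext i
    exact le_antisymm (h i).2 (h i).1

/-- A parallelepiped with `lo ≤ hi` is non-empty (it contains its lower corner). [folklore] -/
private theorem pbox_nonempty {lo hi : Pt d} (h : ∀ i, lo i ≤ hi i) : (pbox lo hi).Nonempty :=
  ⟨lo, mem_pbox.mpr fun i => ⟨le_rfl, h i⟩⟩

/-- A non-empty parallelepiped has `lo ≤ hi`. [folklore] -/
private theorem le_of_pbox_nonempty {lo hi : Pt d} (h : (pbox lo hi).Nonempty) : ∀ i, lo i ≤ hi i := by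
  obtain ⟨y, hy⟩ := h
  rw [mem_pbox] at hy
  exact fun i => (hy i).1.trans (hy i).2

/-- `X` *"is a rectangular parallelepiped"* (non-empty), `Finset` form. [cite: Balaban1989LargeFieldI, p.177] -/
def IsPBox (X : Finset (Pt d)) : Prop := ∃ lo hi : Pt d, (∀ i, lo i ≤ hi i) ∧ X = pbox lo hi

/-- A rectangular parallelepiped (in the sense typed here: `lo ≤ hi`) is a non-empty region. [cite: Balaban1989LargeFieldI, p.177] -/
theorem IsPBox.nonempty {X : Finset (Pt d)} (h : IsPBox X) : X.Nonempty := by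
  obtain ⟨lo, hi, hle, rfl⟩ := h
  exact pbox_nonempty hle

/-- `Finset` parallelepipeds are `B14BoxFix` parallelepipeds ((2.3)'s *"rectangular parallelepiped"*). [cite: Balaban1988Convergent, (2.3) p.255] -/
theorem IsPBox.isBox {X : Finset (Pt d)} (h : IsPBox X) : B14BoxFix.IsBox (↑X : Set (Pt d)) := by
  obtain ⟨lo, hi, -, rfl⟩ := h
  exact ⟨lo, hi, coe_pbox lo hi⟩

/-- Conversely, a non-empty region that is a `B14BoxFix` parallelepiped ((2.3)) is a `Finset` parallelepiped. [cite: Balaban1988Convergent, (2.3) p.255] -/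
theorem isPBox_of_isBox {X : Finset (Pt d)} (hB : B14BoxFix.IsBox (↑X : Set (Pt d))) (hne : X.Nonempty) :
    IsPBox X := by
  obtain ⟨lo, hi, hX⟩ := hB
  have hX' : X = pbox lo hi := Finset.coe_injective (by rw [hX, coe_pbox])
  subst hX'
  exact ⟨lo, hi, le_of_pbox_nonempty hne, rfl⟩

/-- A cube of cubes is a parallelepiped. [folklore] -/
private theorem isPBox_box (c : Pt d) (r : ℕ) : IsPBox (box c r) :=
  ⟨_, _, fun i => by
    have : (0 : ℤ) ≤ r := by positivity
    linarith, box_eq_pbox c r⟩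

/-- A single cube is a parallelepiped. [folklore] -/
private theorem isPBox_singleton (c : Pt d) : IsPBox ({c} : Finset (Pt d)) :=
  ⟨c, c, fun _ => le_rfl, singleton_eq_pbox c⟩

/-! ## Part 2. The region-building operations send parallelepipeds to parallelepipeds (exactly) -/

/-- ONE LAYER OF CUBES AROUND A PARALLELEPIPED IS A PARALLELEPIPED: `[lo, hi]~ = [lo − 1, hi + 1]` (`lo ≤ hi`).
[cite: Balaban1989LargeFieldI, p.177] -/
theorem collar_pbox {lo hi : Pt d} (h : ∀ i, lo i ≤ hi i) :
    collar (pbox lo hi) = pbox (fun i => lo i - 1) (fun i => hi i + 1) := by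
  ext y
  rw [mem_collar, mem_pbox]
  constructor
  · rintro ⟨x, hx, hyx⟩ i
    rw [mem_pbox] at hx
    rw [mem_block] at hyx
    obtain ⟨h1, h2⟩ := hx i
    obtain ⟨h3, h4⟩ := hyx i
    exact ⟨by linarith, by linarith⟩
  · intro hy
    refine ⟨fun i => max (lo i) (min (y i) (hi i)), ?_, ?_⟩
    · rw [mem_pbox]
      intro i
      exact ⟨le_max_left _ _, max_le (h i) (min_le_right _ _)⟩
    · rw [mem_block]
      intro i
      obtain ⟨h1, h2⟩ := hy i
      have hlohi := h i
      rcases le_total (y i) (hi i) with hyh | hyh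
      · rw [min_eq_left hyh]
        rcases le_total (lo i) (y i) with hly | hly
        · rw [max_eq_right hly]
          exact ⟨by linarith, by linarith⟩
        · rw [max_eq_left hly]
          exact ⟨by linarith, by linarith⟩
      · rw [min_eq_right hyh, max_eq_right hlohi]
        exact ⟨by linarith, by linarith⟩

/-- `n` layers: `[lo, hi]^{~n} = [lo − n, hi + n]` — *"adds … ten layers of MR_k-cubes"* acting on a parallelepiped.
[cite: Balaban1989LargeFieldI, p.177] -/
theorem iterate_collar_pbox {lo hi : Pt d} (h : ∀ i, lo i ≤ hi i) (n : ℕ) :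
    collar^[n] (pbox lo hi) = pbox (fun i => lo i - n) (fun i => hi i + n) := by
  induction n with
  | zero => simp
  | succ n ih =>
    rw [Function.iterate_succ_apply', ih]
    have h' : ∀ i, lo i - (n : ℤ) ≤ hi i + n := fun i => by
      have : (0 : ℤ) ≤ n := by positivity
      linarith [h i]
    rw [collar_pbox h']
    congr 1 <;> funext i <;> push_cast <;> ring

/-- Integer division is monotone on the corners: `lo ≤ hi ⇒ ⌊lo/q⌋ ≤ ⌊hi/q⌋` (`q ≥ 1`). [folklore] -/
private theorem coarse_le_coarse {q : ℕ} (hq : 0 < q) {lo hi : Pt d} (h : ∀ i, lo i ≤ hi i) :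
    ∀ i, coarse q lo i ≤ coarse q hi i := fun i => by
  have hq' : (0 : ℤ) < q := by exact_mod_cast hq
  show lo i / (q : ℤ) ≤ hi i / (q : ℤ)
  exact Int.ediv_le_ediv hq' (h i)

/-- THE COVER OF A PARALLELEPIPED BY THE CUBES OF A COARSER NESTED PARTITION IS A PARALLELEPIPED, exactly:
`closureIdx q [lo, hi] = [⌊lo/q⌋, ⌊hi/q⌋]` (`q ≥ 1`, `lo ≤ hi`; onto, because `x = max(lo, qm) ∈ [lo, hi]` has
`⌊x/q⌋ = m` for every `⌊lo/q⌋ ≤ m ≤ ⌊hi/q⌋`) — the mechanism of *"Passing to the next step it is usually rescaled by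
L^{−1}"* on parallelepipeds, and of [LF-II] p. 384 *"S^{n−j}(□) is a cube"*. [cite: Balaban1989LargeFieldI, p.177] -/
theorem closureIdx_pbox {q : ℕ} (hq : 0 < q) {lo hi : Pt d} (h : ∀ i, lo i ≤ hi i) :
    closureIdx q (pbox lo hi) = pbox (coarse q lo) (coarse q hi) := by
  have hq' : (0 : ℤ) < q := by exact_mod_cast hq
  ext m
  rw [closureIdx, Finset.mem_image, mem_pbox]
  constructor
  · rintro ⟨x, hx, rfl⟩ i
    rw [mem_pbox] at hx
    obtain ⟨h1, h2⟩ := hx i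
    show lo i / (q : ℤ) ≤ x i / (q : ℤ) ∧ x i / (q : ℤ) ≤ hi i / (q : ℤ)
    exact ⟨Int.ediv_le_ediv hq' h1, Int.ediv_le_ediv hq' h2⟩
  · intro hm
    refine ⟨fun i => max (lo i) (m i * q), ?_, ?_⟩
    · rw [mem_pbox]
      intro i
      obtain ⟨-, h2⟩ := hm i
      have h2' : m i ≤ hi i / (q : ℤ) := h2
      refine ⟨le_max_left _ _, max_le (h i) ?_⟩
      calc m i * (q : ℤ) ≤ hi i / (q : ℤ) * (q : ℤ) := mul_le_mul_of_nonneg_right h2' hq'.le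
        _ ≤ hi i := Int.ediv_mul_le _ hq'.ne'
    · funext i
      obtain ⟨h1, -⟩ := hm i
      have h1' : lo i / (q : ℤ) ≤ m i := h1
      show max (lo i) (m i * q) / (q : ℤ) = m i
      rcases le_total (lo i) (m i * q) with hle | hle
      · rw [max_eq_right hle]
        exact Int.mul_ediv_cancel _ hq'.ne'
      · rw [max_eq_left hle]
        exact le_antisymm h1' ((Int.le_ediv_iff_mul_le hq').mpr hle)

/-- THE OPERATION `S` ON A PARALLELEPIPED: `S_q[lo, hi] = [⌊lo/q⌋ − 10, ⌊hi/q⌋ + 10]` — one clean renormalization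
step (rescale, add ten layers) maps a rectangular parallelepiped onto a rectangular parallelepiped.
[cite: Balaban1989LargeFieldI, p.177] -/
theorem Sop_pbox {q : ℕ} (hq : 0 < q) {lo hi : Pt d} (h : ∀ i, lo i ≤ hi i) :
    Sop q (pbox lo hi) = pbox (fun i => coarse q lo i - 10) (fun i => coarse q hi i + 10) := by
  unfold Sop
  rw [closureIdx_pbox hq h, iterate_collar_pbox (coarse_le_coarse hq h) 10]
  simp only [Nat.cast_ofNat]

/-- One layer of cubes keeps rectangular parallelepipeds (a step of *"adds … layers of MR_k-cubes"* on the regions of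
p. 177). [cite: Balaban1989LargeFieldI, p.177] -/
theorem IsPBox.collar {X : Finset (Pt d)} (hX : IsPBox X) : IsPBox (collar X) := by
  obtain ⟨lo, hi, hle, rfl⟩ := hX
  refine ⟨_, _, fun i => ?_, collar_pbox hle⟩
  linarith [hle i]

/-- Covering by a coarser nested partition keeps rectangular parallelepipeds (`q ≥ 1`; *"Passing to the next step it
is usually rescaled by L^{−1}"* on the regions of p. 177). [cite: Balaban1989LargeFieldI, p.177] -/
theorem IsPBox.closureIdx {q : ℕ} (hq : 0 < q) {X : Finset (Pt d)} (hX : IsPBox X) :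
    IsPBox (closureIdx q X) := by
  obtain ⟨lo, hi, hle, rfl⟩ := hX
  exact ⟨_, _, coarse_le_coarse hq hle, closureIdx_pbox hq hle⟩

/-- One clean renormalization step keeps parallelepipeds (`q ≥ 1`). [cite: Balaban1989LargeFieldI, p.177] -/
theorem IsPBox.Sop {q : ℕ} (hq : 0 < q) {X : Finset (Pt d)} (hX : IsPBox X) : IsPBox (Sop q X) := by
  obtain ⟨lo, hi, hle, rfl⟩ := hX
  refine ⟨_, _, fun i => ?_, Sop_pbox hq hle⟩
  linarith [coarse_le_coarse hq hle i]

/-- Any number of clean renormalization steps keeps parallelepipeds (ratios `q_l ≥ 1`). [cite: Balaban1989LargeFieldI, p.177] -/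
theorem IsPBox.Siter {q : ℕ → ℕ} (hq : ∀ l, 0 < q l) {X : Finset (Pt d)} (hX : IsPBox X) :
    ∀ i, IsPBox (Siter q i X)
  | 0 => by simpa using hX
  | i + 1 => by
    rw [Siter_succ]
    exact (IsPBox.Siter hq hX i).Sop (hq i)

/-! ## Part 3. «For such a component all the regions connected with the last N steps are rectangular parallelepipeds» -/

/-- THE ONE-LINE INFERENCE FROM (2.3) [III]: under *"our rule of construction of the large field regions"* (`Cond23`:
every component of `Z` that fits in a cube of `Nsz` cubes per side is a parallelepiped), a component satisfying
condition (i) IS a rectangular parallelepiped. [cite: Balaban1989LargeFieldI, p.177] -/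
theorem isBox_of_rule23 {Nsz : ℕ} {Z : Set (Pt d)} (h23 : B14BoxFix.Cond23 Nsz Z) {a : Pt d} (ha : a ∈ Z)
    (hfit : B14BoxFix.FitsIn Nsz (B14Components.tComp Z a)) : B14BoxFix.IsBox (B14Components.tComp Z a) :=
  h23 a ha hfit

/-- READING (A), in the vocabulary of `…B16StoppingRule` and `…B14BoxFix`: a component tracked through the scales
(`X l` = its region at scale `l`, a component of the scale-`l` large field region `Z l`), satisfying (i) at `k`
(`CondI Nsz (X k)`) and (ii) with memory `N` at `k` (`CondII Nsz N Clean X k`: at the scales `k − N < l ≤ k` no new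
large fields and (i) holds), under the rule (2.3) [III] at every scale (`Cond23 Nsz (Z l)`): the component AND *"all the
regions connected with the last N steps are rectangular parallelepipeds"*. [cite: Balaban1989LargeFieldI, p.177] -/
theorem claim177_of_condII {Nsz N k : ℕ} {Clean : ℕ → Prop} {X : ℕ → Finset (Pt d)} {Z : ℕ → Set (Pt d)}
    (h23 : ∀ l, B14BoxFix.Cond23 Nsz (Z l))
    (hcomp : ∀ l, ∃ a ∈ Z l, (↑(X l) : Set (Pt d)) = B14Components.tComp (Z l) a)
    (hi : B16StoppingRule.CondI Nsz (X k)) (hii : B16StoppingRule.CondII Nsz N Clean X k) :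
    B14BoxFix.IsBox (↑(X k) : Set (Pt d)) ∧ ∀ l, k < l + N → l ≤ k → B14BoxFix.IsBox (↑(X l) : Set (Pt d)) := by
  have key : ∀ l, B16StoppingRule.CondI Nsz (X l) → B14BoxFix.IsBox (↑(X l) : Set (Pt d)) := by
    intro l hl
    obtain ⟨a, ha, hXa⟩ := hcomp l
    unfold B16StoppingRule.CondI at hl
    rw [hXa] at hl ⊢
    exact isBox_of_rule23 (h23 l) ha hl
  exact ⟨key k hi, fun l h1 h2 => key l (hii.2 l h1 h2).2⟩

/-- READING (B), constructive: a region that is a rectangular parallelepiped at the first scale of the window STAYS one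
at every later scale under the clean steps `S` ([LF-II]'s model of a step creating no new large fields) — whatever the
ratios `q_l ≥ 1` (gain or no-gain steps). [cite: Balaban1989LargeFieldI, p.177] -/
theorem claim177_Siter {q : ℕ → ℕ} (hq : ∀ l, 0 < q l) {X₀ : Finset (Pt d)}
    (hB : B14BoxFix.IsBox (↑X₀ : Set (Pt d))) (hne : X₀.Nonempty) (l : ℕ) :
    B14BoxFix.IsBox (↑(Siter q l X₀) : Set (Pt d)) :=
  ((isPBox_of_isBox hB hne).Siter hq l).isBox

/-- READINGS (A)+(B) combined: under (2.3) [III] at the first scale of the window, a component satisfying (i) there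
(a finite set, `B14BoxFix.FitsIn.finite`) is a parallelepiped, and so are all the regions it becomes in the following
clean steps. [cite: Balaban1989LargeFieldI, p.177] -/
theorem claim177_window {Nsz : ℕ} {Z : Set (Pt d)} (h23 : B14BoxFix.Cond23 Nsz Z) {a : Pt d} (ha : a ∈ Z)
    (hfit : B14BoxFix.FitsIn Nsz (B14Components.tComp Z a)) {q : ℕ → ℕ} (hq : ∀ l, 0 < q l) (l : ℕ) :
    B14BoxFix.IsBox (↑(Siter q l hfit.finite.toFinset) : Set (Pt d)) := by
  refine claim177_Siter hq ?_ ?_ l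
  · rw [Set.Finite.coe_toFinset]
    exact isBox_of_rule23 h23 ha hfit
  · exact ⟨a, by rw [Set.Finite.mem_toFinset]; exact Relation.ReflTransGen.refl⟩

/-! ## Part 4. «The size must be greater than 20MR_k … greater than 40MR_k» -/

/-- `n` layers around any cube of `X` lie in `X^{~n}`: `□^{~n} ⊆ X^{~n}` for `□ ⊂ X`. [folklore] -/
private theorem box_subset_iterate_collar {X : Finset (Pt d)} {x : Pt d} (hx : x ∈ X) (n : ℕ) :
    box x n ⊆ collar^[n] X := by
  have h1 : collar^[n] ({x} : Finset (Pt d)) = box x n := by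
    rw [singleton_eq_pbox, iterate_collar_pbox (fun _ => le_rfl) n, box_eq_pbox]
  rw [← h1]
  exact iterate_collar_mono n (Finset.singleton_subset_iff.mpr hx)

/-- *"Each renormalization step adds at least ten layers of MR_k-cubes, hence the size must be greater than 20MR_k"*:
after one step (any ratio `q`, gain or no-gain) the region contains a full cube of cubes `□₀^{~10}` — `21 > 20` cubes
along every axis. [cite: Balaban1989LargeFieldI, p.177] -/
theorem exists_box_subset_Sop (q : ℕ) {X : Finset (Pt d)} (hX : X.Nonempty) : ∃ c, box c 10 ⊆ Sop q X := by
  obtain ⟨x, hx⟩ := hX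
  exact ⟨coarse q x, box_subset_iterate_collar (Finset.mem_image_of_mem (coarse q) hx) 10⟩

/-- Hence at least `21^d` cubes. [cite: Balaban1989LargeFieldI, p.177] -/
theorem card_Sop_ge (q : ℕ) {X : Finset (Pt d)} (hX : X.Nonempty) : 21 ^ d ≤ (Sop q X).card := by
  obtain ⟨c, hc⟩ := exists_box_subset_Sop q hX
  calc 21 ^ d = (box c 10).card := by rw [card_box]
    _ ≤ (Sop q X).card := Finset.card_le_card hc

/-- … and two cubes of the region `20` apart in EVERY coordinate («size greater than 20MR_k»: `21` cubes from the one
to the other, ends included). [cite: Balaban1989LargeFieldI, p.177] -/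
theorem exists_far_pair_Sop (q : ℕ) {X : Finset (Pt d)} (hX : X.Nonempty) :
    ∃ y ∈ Sop q X, ∃ z ∈ Sop q X, ∀ i, z i - y i = 20 := by
  obtain ⟨c, hc⟩ := exists_box_subset_Sop q hX
  refine ⟨fun i => c i - 10, hc (mem_box.mpr fun i => ⟨by push_cast; linarith, by push_cast; linarith⟩),
    fun i => c i + 10, hc (mem_box.mpr fun i => ⟨by push_cast; linarith, by push_cast; linarith⟩), fun i => ?_⟩
  ring

/-- *"in some steps the number R_k decreases by the factor L^{−1}, and adding ten new layers of MR_k-cubes we get a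
region with a size greater than 40MR_k"*: a NO-GAIN step (ratio `1`: the partition does not change) applied to a
region that already underwent a step contains a full `□₀^{~20}` — `41 > 40` cubes along every axis.
[cite: Balaban1989LargeFieldI, p.177] -/
theorem exists_box_subset_Sop_one_Sop (q : ℕ) {X : Finset (Pt d)} (hX : X.Nonempty) :
    ∃ c, box c 20 ⊆ Sop 1 (Sop q X) := by
  obtain ⟨c, hc⟩ := exists_box_subset_Sop q hX
  refine ⟨c, ?_⟩
  have h1 : collar^[10] (box c 10) = box c 20 := by
    rw [box_eq_pbox, iterate_collar_pbox (fun i => by push_cast; linarith) 10, box_eq_pbox]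
    congr 1 <;> funext i <;> push_cast <;> ring
  unfold Sop
  rw [closureIdx_one, ← h1]
  exact iterate_collar_mono 10 hc

/-- Every iterate past the first contains a full `□₀^{~10}` of the current partition. [cite: Balaban1989LargeFieldI, p.177] -/
theorem exists_box_subset_Siter_succ (q : ℕ → ℕ) {X : Finset (Pt d)} (hX : X.Nonempty) (i : ℕ) :
    ∃ c, box c 10 ⊆ Siter q (i + 1) X := by
  rw [Siter_succ]
  exact exists_box_subset_Sop (q i) (Siter_nonempty q hX i)

/-- Integer division is superadditive: `⌊a/c⌋ + ⌊b/c⌋ ≤ ⌊(a+b)/c⌋` (`c > 0`). [folklore] -/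
private theorem ediv_add_ediv_le {a b c : ℤ} (hc : 0 < c) : a / c + b / c ≤ (a + b) / c := by
  rw [Int.le_ediv_iff_mul_le hc, add_mul]
  have h1 := Int.ediv_mul_le a hc.ne'
  have h2 := Int.ediv_mul_le b hc.ne'
  linarith

/-- THE SINGLE-CUBE STEP FROM BELOW: `□′^{~(⌊r/q⌋+10)} ⊆ S_q(□^{~r})` about the coarse cube `□′ ∋ □` — with
`B16SProfile.Sop_box_subset` (`⊆ □′^{~(⌊r/q⌋+11)}`) the radius of the iterate of a cube of cubes obeys
`⌊r/q⌋ + 10 ≤ r′ ≤ ⌊r/q⌋ + 11` (*"usually rescaled by L^{−1}"*, `q = L`; no-gain `q = 1`: `r′ = r + 10` exactly,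
`B16SProfile.Sop_one_box_subset`). [cite: Balaban1989LargeFieldI, p.177] -/
theorem box_subset_Sop_box {q : ℕ} (hq : 0 < q) (c : Pt d) (r : ℕ) :
    box (coarse q c) (r / q + 10) ⊆ Sop q (box c r) := by
  have hq' : (0 : ℤ) < q := by exact_mod_cast hq
  have hr : (0 : ℤ) ≤ r := by positivity
  rw [box_eq_pbox c r, Sop_pbox hq (fun i => by linarith)]
  intro y hy
  rw [mem_box] at hy
  rw [mem_pbox]
  intro i
  obtain ⟨h1, h2⟩ := hy i
  have hlo : (c i - r) / (q : ℤ) + (r : ℤ) / (q : ℤ) ≤ c i / (q : ℤ) := by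
    have := ediv_add_ediv_le (a := c i - r) (b := (r : ℤ)) hq'
    rwa [sub_add_cancel] at this
  have hhi : c i / (q : ℤ) + (r : ℤ) / (q : ℤ) ≤ (c i + r) / (q : ℤ) := ediv_add_ediv_le hq'
  have e1 : coarse q c i = c i / (q : ℤ) := rfl
  have e2 : coarse q (fun i => c i - r) i = (c i - r) / (q : ℤ) := rfl
  have e3 : coarse q (fun i => c i + r) i = (c i + r) / (q : ℤ) := rfl
  rw [e1] at h1 h2
  rw [e2, e3]
  push_cast at h1 h2
  exact ⟨by linarith, by linarith⟩

/-! ## Part 5. «The minimal size is approximately equal to 42(L/(L−1))MR_k» -/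

/-- The per-step size budget behind the figure `42(L/(L−1))`: rescale by `L^{−1}`, add the budget `a` (print: `a = 42`,
[LF-II] p. 384 *"L_{n−j} ≤ 42(1 − L^{−(n−j)})/(1 − L^{−1})"*): `b_0 = 0`, `b_{m+1} = b_m/L + a`.
[cite: Balaban1989LargeFieldII, p.384 (display after (1.80))] -/
noncomputable def budget (L a : ℝ) : ℕ → ℝ
  | 0 => 0
  | m + 1 => budget L a m / L + a

/-- CLOSED FORM = THE PRINTED BOUND: `b_m = a(1 − L^{−m})/(1 − L^{−1})` (`L ≠ 0, 1`). [cite: Balaban1989LargeFieldII, p.384 (display after (1.80))] -/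
theorem budget_closed {L : ℝ} (hL0 : L ≠ 0) (hL1 : L ≠ 1) (a : ℝ) :
    ∀ m, budget L a m = a * (1 - (1 / L) ^ m) / (1 - 1 / L)
  | 0 => by simp [budget]
  | m + 1 => by
    have h1 : (1 : ℝ) - 1 / L ≠ 0 := by
      intro h
      apply hL1
      field_simp at h
      linarith
    rw [budget, budget_closed hL0 hL1 a m, div_eq_mul_one_div (a * (1 - (1 / L) ^ m) / (1 - 1 / L)) L,
      pow_succ]
    generalize (1 / L : ℝ) = t at h1 ⊢
    field_simp
    ring

/-- The limit value `a·L/(L−1) = a/(1 − L^{−1})`. [folklore] -/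
private theorem limit_eq {L : ℝ} (hL0 : L ≠ 0) (hL1 : L ≠ 1) (a : ℝ) : a * (L / (L - 1)) = a / (1 - 1 / L) := by
  have h : L - 1 ≠ 0 := sub_ne_zero.mpr hL1
  field_simp

/-- The budget as the limit value times the defect `1 − L^{−m}`. [folklore] -/
private theorem budget_eq_limit_mul {L : ℝ} (hL0 : L ≠ 0) (hL1 : L ≠ 1) (a : ℝ) (m : ℕ) :
    budget L a m = a * (L / (L - 1)) * (1 - (1 / L) ^ m) := by
  rw [budget_closed hL0 hL1, limit_eq hL0 hL1]
  have h1 : (1 : ℝ) - 1 / L ≠ 0 := by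
    intro h
    apply hL1
    field_simp at h
    linarith
  field_simp

/-- THE BUDGET STAYS STRICTLY BELOW `a·L/(L−1)` (`L > 1`, `a > 0`) — the sizes of the iterates of a minimal region never
reach the «approximately equal» value from above in this bookkeeping. [cite: Balaban1989LargeFieldI, p.177] -/
theorem budget_lt_limit {L a : ℝ} (hL : 1 < L) (ha : 0 < a) (m : ℕ) : budget L a m < a * (L / (L - 1)) := by
  have hL0 : L ≠ 0 := by positivity
  rw [budget_eq_limit_mul hL0 hL.ne' a m]
  have hlim : 0 < a * (L / (L - 1)) := by
    have : 0 < L - 1 := by linarith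
    positivity
  have hpow : 0 < (1 / L) ^ m := by positivity
  nlinarith

/-- The budget increases with the number of steps (`L > 1`, `a ≥ 0`): the bound for the size of a minimal region grows
towards «approximately 42(L/(L−1))» from below. [cite: Balaban1989LargeFieldI, p.177] -/
theorem budget_le_succ {L a : ℝ} (hL : 1 < L) (ha : 0 ≤ a) (m : ℕ) : budget L a m ≤ budget L a (m + 1) := by
  have hL0 : L ≠ 0 := by positivity
  rw [budget_eq_limit_mul hL0 hL.ne' a m, budget_eq_limit_mul hL0 hL.ne' a (m + 1)]
  have hlim : 0 ≤ a * (L / (L - 1)) := by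
    have : 0 < L - 1 := by linarith
    positivity
  have h1 : (0 : ℝ) ≤ 1 / L := by positivity
  have h2 : 1 / L ≤ 1 := by rw [div_le_one (by linarith)]; exact hL.le
  have hpow : (1 / L) ^ (m + 1) ≤ (1 / L) ^ m := pow_le_pow_of_le_one h1 h2 (Nat.le_succ m)
  nlinarith

/-- *"the minimal size is approximately equal to 42(L/(L−1))MR_k"* AS A LIMIT STATEMENT: the per-step budget
`b_{m+1} = b_m/L + a` tends to `a·L/(L−1)` (`L > 1`; print `a = 42`). [cite: Balaban1989LargeFieldI, p.177] -/
theorem tendsto_budget {L : ℝ} (hL : 1 < L) (a : ℝ) :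
    Filter.Tendsto (budget L a) Filter.atTop (nhds (a * (L / (L - 1)))) := by
  have hL0 : L ≠ 0 := by positivity
  have h1 : (0 : ℝ) ≤ 1 / L := by positivity
  have h2 : 1 / L < 1 := by rw [div_lt_one (by linarith)]; exact hL
  have hpow := tendsto_pow_atTop_nhds_zero_of_lt_one h1 h2
  have hfun : budget L a = fun m => a * (L / (L - 1)) * (1 - (1 / L) ^ m) :=
    funext fun m => budget_eq_limit_mul hL0 hL.ne' a m
  rw [hfun]
  have := ((tendsto_const_nhds (x := (1 : ℝ))).sub hpow).const_mul (a * (L / (L - 1)))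
  simpa using this

/-- With print's `a = 42`: `42·L/(L−1) ≤ 63 ⇔ L ≥ 3` — the limit size of a minimal region is within the `63 < 100` of
[LF-II] p. 384 exactly for `L ≥ 3`. [cite: Balaban1989LargeFieldII, p.384 (display after (1.80))] -/
theorem limit_le_63_iff {L : ℝ} (hL : 1 < L) : 42 * (L / (L - 1)) ≤ 63 ↔ 3 ≤ L := by
  have h : 0 < L - 1 := by linarith
  rw [mul_div_assoc', div_le_iff₀ h]
  constructor <;> intro hh <;> linarith

/-- … and every budget value is `< 63` for `L ≥ 3` — BY NAME the tree's check of the printed *"< 63"*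
(`Step.Budget.L_iter_lt_63`). [cite: Balaban1989LargeFieldII, p.384 (display after (1.80))] -/
theorem budget_lt_63 {L : ℝ} (hL : 3 ≤ L) (m : ℕ) : budget L 42 m < 63 := by
  have hL0 : L ≠ 0 := by positivity
  have hL1 : L ≠ 1 := by intro h; linarith
  have h63 := Step.Budget.L_iter_lt_63 L hL m
  rw [budget_closed hL0 hL1]
  have hden : 0 < 1 - 1 / L := by
    have : 1 / L ≤ 1 / 3 := one_div_le_one_div_of_le (by norm_num) hL
    linarith
  rw [div_lt_iff₀ hden, one_div_pow]
  exact h63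

/-- IN THE INDEX MODEL ITSELF: a region grown from ONE large-field cube by `i ≤ m` clean steps under the drop control
of the sizes `R_n = L^{σ_n}` coming from (2.9) [III] (`B16SProfile.DropCtl`, `L ≥ 3`) lies in a cube of cubes of radius
`≤ 31` (`B16SProfile.Siter_singleton_subset_box`), hence satisfies condition (i) with print's `100` — *"We consider
components of almost the minimal possible size … of sizes smaller than, or equal to 100MR_k"* is automatic for them.
[cite: Balaban1989LargeFieldI, p.177 (condition (i))] -/
theorem condI_single_cube {L : ℕ} {σ : ℕ → ℕ} {m i : ℕ} (hL : 3 ≤ L) (h : DropCtl σ m) (z : Pt d) (hi : i ≤ m) :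
    B16StoppingRule.CondI 100 (Siter (ratio L σ) i {z}) := by
  obtain ⟨r, ⟨hr31, -⟩, hsub⟩ := Siter_singleton_subset_box hL h z i hi
  set c := coarse (Qprod (ratio L σ) i) z with hc
  refine ⟨fun μ => c μ - r, ?_⟩
  intro y hy
  have hy' : y ∈ box c r := hsub (Finset.mem_coe.mp hy)
  rw [mem_box] at hy'
  intro μ
  obtain ⟨h1, h2⟩ := hy' μ
  have hr : (r : ℤ) ≤ 31 := by exact_mod_cast hr31
  refine ⟨h1, ?_⟩
  push_cast
  linarith

/-- The same regions are rectangular parallelepipeds at every scale (Part 2), as p. 177 says of the regions of the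
class considered. [cite: Balaban1989LargeFieldI, p.177] -/
theorem isPBox_single_cube {q : ℕ → ℕ} (hq : ∀ l, 0 < q l) (z : Pt d) (i : ℕ) : IsPBox (Siter q i {z}) :=
  (isPBox_singleton z).Siter hq i

/-! ## Part 6 (v1.1, append-only). The ALL-GAIN iterate of a single cube: kernel evidence for GAPS.md G-B15-01

Along steps that all gain the factor `L^{−1}` (*"Passing to the next step it is usually rescaled by L^{−1}"* — ratio
`q = L` throughout), the region grown from ONE large-field cube stays, after ANY number of steps, inside a cube of cubes
of radius `r` with `(L − 1)·r ≤ 11·L`, i.e. `r ≤ 11L/(L−1)` and linear size `≤ 2⌊11L/(L−1)⌋ + 1` cubes — about half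
of print's «approximately 42(L/(L−1))MR_k» (which is the limit of the [LF-II] p. 384 per-step BOUND, Part 5), and it
contains a full `□₀^{~10}` about the same centre after the first step (Part 4).  Recorded in HOME `GAPS.md` G-B15-01 as
a READING NOTE (which history print calls «the minimal size» is not specified in print); nothing is adjudicated. -/

/-- One all-gain step on the radius bound: if `(L−1)·r ≤ 11L` then `(L−1)·(⌊r/L⌋ + 11) ≤ 11L` (`L ≥ 1`) — the
stationary value `11L/(L−1)` of the recursion `r ↦ ⌊r/L⌋ + 11` is never exceeded from below.
[cite: Balaban1989LargeFieldI, p.177] -/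
theorem radius_step_bound {L r : ℕ} (hL : 1 ≤ L) (hr : (L - 1) * r ≤ 11 * L) : (L - 1) * (r / L + 11) ≤ 11 * L := by
  have hL0 : 0 < L := hL
  have hdiv : L * (r / L) ≤ r := Nat.mul_div_le r L
  have h1 : L * ((L - 1) * (r / L)) ≤ L * 11 := by
    calc L * ((L - 1) * (r / L)) = (L - 1) * (L * (r / L)) := by ring
      _ ≤ (L - 1) * r := Nat.mul_le_mul_left _ hdiv
      _ ≤ 11 * L := hr
      _ = L * 11 := by ring
  have h2 : (L - 1) * (r / L) ≤ 11 := Nat.le_of_mul_le_mul_left h1 hL0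
  have h3 : (L - 1) * 11 ≤ 11 * L - 11 := by omega
  calc (L - 1) * (r / L + 11) = (L - 1) * (r / L) + (L - 1) * 11 := by ring
    _ ≤ 11 + (11 * L - 11) := Nat.add_le_add h2 h3
    _ = 11 * L := by omega

/-- THE ALL-GAIN ITERATE OF A SINGLE CUBE IS SMALL: after `m` steps with ratio `L` each (`L ≥ 1`), `S^{m}(□)` lies in
the cube of cubes of some radius `r` with `(L − 1)·r ≤ 11·L` about the cube `⌊□/L^m⌋` of the current partition
containing `□` (by `B16SProfile.Sop_box_subset` and `radius_step_bound`).  For `L ≥ 2` this is `r ≤ 22`, for `L ≥ 3`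
`r ≤ 16` (linear size `≤ 33` cubes), for `L ≥ 12` `r ≤ 12` — in every case well below print's «≈ 42(L/(L−1))» cubes,
which budgets the no-gain steps of (2.9) [III] (Part 5, `B16SProfile.RadInv`). [cite: Balaban1989LargeFieldI, p.177] -/
theorem allGain_iterate_subset_box {L : ℕ} (hL : 1 ≤ L) (z : Pt d) :
    ∀ m, ∃ r : ℕ, (L - 1) * r ≤ 11 * L ∧ Siter (fun _ => L) m {z} ⊆ box (coarse (L ^ m) z) r
  | 0 => ⟨0, by simp, by
      rw [Siter_zero, pow_zero, coarse_one]
      exact Finset.singleton_subset_iff.mpr (mem_box_self z 0)⟩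
  | m + 1 => by
    obtain ⟨r, hr, hsub⟩ := allGain_iterate_subset_box hL z m
    refine ⟨r / L + 11, radius_step_bound hL hr, ?_⟩
    rw [Siter_succ]
    calc Sop L (Siter (fun _ => L) m {z}) ⊆ Sop L (box (coarse (L ^ m) z) r) := Sop_mono L hsub
      _ ⊆ box (coarse L (coarse (L ^ m) z)) (r / L + 11) := Sop_box_subset hL _ r
      _ = box (coarse (L ^ (m + 1)) z) (r / L + 11) := by rw [coarse_coarse, ← pow_succ]

/-- The same with the radius made explicit for `L ≥ 2`: `r ≤ 22`, so at most `45` cubes along every axis — versus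
print's `42·L/(L−1) ≥ 42`·(anything) only in the sense of Part 5's bound; for `L ≥ 3` the index model gives `≤ 33 < 63`.
[cite: Balaban1989LargeFieldI, p.177] -/
theorem allGain_iterate_radius_le_22 {L : ℕ} (hL : 2 ≤ L) (z : Pt d) (m : ℕ) :
    ∃ r : ℕ, r ≤ 22 ∧ Siter (fun _ => L) m {z} ⊆ box (coarse (L ^ m) z) r := by
  obtain ⟨r, hr, hsub⟩ := allGain_iterate_subset_box (show 1 ≤ L by omega) z m
  refine ⟨r, ?_, hsub⟩
  -- (L − 1)·r ≤ 11L with L ≥ 2: r ≤ 11L/(L−1) ≤ 22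
  by_contra h
  have h1 : (L - 1) * 23 ≤ (L - 1) * r := Nat.mul_le_mul_left _ (by omega)
  have h2 : (L - 1) * 23 ≤ 11 * L := h1.trans hr
  omega

/-- … and for `L ≥ 3`: `r ≤ 16`, linear size `≤ 33` cubes. [cite: Balaban1989LargeFieldI, p.177] -/
theorem allGain_iterate_radius_le_16 {L : ℕ} (hL : 3 ≤ L) (z : Pt d) (m : ℕ) :
    ∃ r : ℕ, r ≤ 16 ∧ Siter (fun _ => L) m {z} ⊆ box (coarse (L ^ m) z) r := by
  obtain ⟨r, hr, hsub⟩ := allGain_iterate_subset_box (show 1 ≤ L by omega) z m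
  refine ⟨r, ?_, hsub⟩
  by_contra h
  have h1 : (L - 1) * 17 ≤ (L - 1) * r := Nat.mul_le_mul_left _ (by omega)
  have h2 : (L - 1) * 17 ≤ 11 * L := h1.trans hr
  omega

end

end Literature.MathematicalPhysics.QuantumFieldTheory.Balaban1983to89.B15Claim177
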